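/-
Copyright: the b2b-balaban T⁴-continuum CRUX team, row NE7b OWNER lineage `t4-ne7b-p1` (gen 141). Project licence.
-/
import Summits.QuantumFields.BalabanUV.T4Continuum.Spine.NE7b.SupDobrushinThirdCumulant
import Summits.QuantumFields.BalabanUV.T4Continuum.Spine.NE7b.SupTruncationGroupBound

/-!
# DOBRUSHIN ACROSS A CUT: THE COVARIANCE OF TWO CLAMPED PRODUCTS, AND THE `2|2` GROUP BOUND (SCOPING (d13)(2), fourth file — the order-4
# analogue of (461)).  For the cut `{1,2}|{3,4}` the clamped products `X′ = T_R(F₁−m₁)·T_R(F₂−m₂)` and `Y′ = T_R(F₃−m₃)·T_R(F₄−m₄)` are in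
# the coordinate-Lipschitz class with vectors `R(a₁+a₂)`, `R(a₃+a₄)` ((461) `clamped_prod_lipVec`), so (447) gives
#   `|Cov_ν(X′, Y′)| ≤ R²·Σ_w ((Dᵀa₁)_w + (Dᵀa₂)_w)((Dᵀa₃)_w + (Dᵀa₄)_w)∕c_w`,
# and with (486)'s defect, for every `R > 0` and arbitrary centring constants,
#   `|∫f₁f₂f₃f₄ dν − (∫f₁f₂)(∫f₃f₄)| ≤ R²·Σ_w(Dᵀ(a₁+a₂))_w(Dᵀ(a₃+a₄))_w∕c_w + (2m₄ + 2m₆ + 2m₂(m₂+m₄))∕R`   (`f_i = F_i − m_i`)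
# — the bilinear form expands into the four crossing pairs `B(a₁,a₃) + B(a₁,a₄) + B(a₂,a₃) + B(a₂,a₄)`, each decaying across the cut by (466);
# for the `1|3` cuts, likewise with `F₁` unclamped against the triple clamped product (vector `R²(a₂+a₃+a₄)`, §1) (row NE7b, node U5c;
# (447) `abs_cov_le_kernel_gibbs`, (461) `clamp_centred_lipVec`∕`clamped_prod_lipVec`, (486) `cov_group_le_of_truncated`, (446)∕(445) class
# lemmas BY NAME; [folklore])

Cell `pub-balaban`, sub-cell `t4`, spine estimate NE7b (`T4WeightBudget.RelWeightBound`; the cell's OWN estimate — NOT PRINTED in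
[Bałaban 1983–89], NOT PROVED).  Crux-route work under `Spine/NE7b/` by the row OWNER (`t4-ne7b-p1` gen 141, file (489)) under FREEZE
(0)'s crux-prover clause; NOTHING of Bałaban's is named as a Lean object, valued or asserted; no `T4Continuum/Support` leaf typed; no
`def`, no notation; zero `sorry`.  Imports (BY NAME): the OWNER's (461) `…SupDobrushinThirdCumulant` (`clamp_centred_lipVec`, `clamped_prod_lipVec`;
through it (447), (446) `memLp_coord_tilted`, (445) `SupCoordinateLipschitzClass.*`), (486) `…SupTruncationGroupBound` (`cov_group_le_of_truncated`).

WHAT IS PROVED ([folklore]):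
* §1 `clamped_triple_lipVec` (`T_Rf₂·T_Rf₃·T_Rf₄` has vector `R²(a₂+a₃+a₄)`), **`clamped_pair_cov_le`** (the display, cut `2|2`),
  **`single_clamped_triple_cov_le`** (cut `1|3`: `|Cov_ν(F₁, T_Rf₂T_Rf₃T_Rf₄)| ≤ R²·Σ_w(Dᵀa₁)_w(Dᵀ(a₂+a₃+a₄))_w∕c_w`).
* §2 THE END **`group_cov_two_two_le`** (the `2|2` group bound with (486)'s defect); §3 toy.

HONEST (what this is NOT).  The `2|2` cut end to end and the Dobrushin side of the `1|3` cuts; the `1|3` truncation defect (three clamps against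
one free factor), the sixth moments, the per-cut assembly with the weights and (487)∕(488) are the next files; scalar skeleton ((A3), NC-NE7b-α
UNRULED); nothing of Bałaban's asserted.  BY-NAME EFFECT ON THE WALL: NONE.  NE7b NOT PRINTED ∕ NOT PROVED; spine PROVED 0∕9; rung (B)+1 — the
programme's measures remain FINITE-torus statements; NOT the mass gap, NOT Clay.  HONEST DEPENDENCY: continuum YM on T⁴ ⇐ BetaPertH ∧ nine
spine estimates (0∕9 proved); BetaPertH ⇐ (D1) ∧ (D4) ∧ CAP+tail; G-an2-4 gates asym, D1 and NE2∕3∕4.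
-/

set_option autoImplicit false

noncomputable section

namespace Summit.QuantumFields.BalabanUV.T4Continuum.NE7b.SupDobrushinGroupCovariance

open MeasureTheory Real Set Function Finset
open scoped BigOperators
open SupDobrushinCovarianceGibbs (abs_cov_le_kernel_gibbs)
open SupOneSiteResamplingInvariance (memLp_coord_tilted)
open SupDobrushinThirdCumulant (clamp_centred_lipVec clamped_prod_lipVec)
open SupTruncationGroupBound (cov_group_le_of_truncated)

variable {ι : Type} [Fintype ι] [DecidableEq ι]

variable {V : (ι → ℝ) → ℝ} {V₁ : ι → (ι → ℝ) → ℝ} {c : ι → ℝ} {Cw γ : ℝ} {J D : ι → ι → ℝ}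
  {P : ι → ((ι → ℝ) → ℝ) → ((ι → ℝ) → ℝ)} {F₁ F₂ F₃ F₄ : (ι → ℝ) → ℝ} {a₁ a₂ a₃ a₄ : ι → ℝ}

/-! ## §1. Clamped products across a cut -/

omit [Fintype ι] in
/-- **The triple clamped product `T_R(F₂−m₂)·T_R(F₃−m₃)·T_R(F₄−m₄)` has vector `R²(a₂+a₃+a₄)`**. [folklore] -/
theorem clamped_triple_lipVec (h2 : ∀ z ω s t, |F₂ (update ω z s) - F₂ (update ω z t)| ≤ a₂ z * |s - t|)
    (h3 : ∀ z ω s t, |F₃ (update ω z s) - F₃ (update ω z t)| ≤ a₃ z * |s - t|)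
    (h4 : ∀ z ω s t, |F₄ (update ω z s) - F₄ (update ω z t)| ≤ a₄ z * |s - t|) (m₂ m₃ m₄ : ℝ) {R : ℝ} (hR : 0 ≤ R) (z : ι) (ω : ι → ℝ)
    (s t : ℝ) :
    |max (-R) (min R (F₂ (update ω z s) - m₂)) * max (-R) (min R (F₃ (update ω z s) - m₃)) * max (-R) (min R (F₄ (update ω z s) - m₄)) -
        max (-R) (min R (F₂ (update ω z t) - m₂)) * max (-R) (min R (F₃ (update ω z t) - m₃)) * max (-R) (min R (F₄ (update ω z t) - m₄))| ≤
      (R ^ 2 * (a₂ z + a₃ z + a₄ z)) * |s - t| := by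
  set x := max (-R) (min R (F₂ (update ω z s) - m₂)) * max (-R) (min R (F₃ (update ω z s) - m₃))
  set x' := max (-R) (min R (F₂ (update ω z t) - m₂)) * max (-R) (min R (F₃ (update ω z t) - m₃))
  set y := max (-R) (min R (F₄ (update ω z s) - m₄))
  set y' := max (-R) (min R (F₄ (update ω z t) - m₄))
  have hTR : ∀ u : ℝ, |max (-R) (min R u)| ≤ R := fun u => abs_le.2 ⟨le_max_left _ _, max_le (by linarith) (min_le_left _ _)⟩
  have hx : |x| ≤ R * R := by
    rw [abs_mul]; exact mul_le_mul (hTR _) (hTR _) (abs_nonneg _) hR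
  have hxx' : |x - x'| ≤ (R * (a₂ z + a₃ z)) * |s - t| := clamped_prod_lipVec h2 h3 m₂ m₃ hR z ω s t
  have hyy' : |y - y'| ≤ a₄ z * |s - t| := clamp_centred_lipVec h4 m₄ R z ω s t
  have e : x * y - x' * y' = x * (y - y') + (x - x') * y' := by ring
  rw [e]
  refine (abs_add_le _ _).trans ?_
  rw [abs_mul x (y - y'), abs_mul (x - x') y']
  have ha₂ := SupCoordinateLipschitzClass.lipVec_nonneg h2 z
  have ha₃ := SupCoordinateLipschitzClass.lipVec_nonneg h3 z
  have h1 : |x| * |y - y'| ≤ (R * R) * (a₄ z * |s - t|) := mul_le_mul hx hyy' (abs_nonneg _) (mul_nonneg hR hR)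
  have h2' : |x - x'| * |y'| ≤ ((R * (a₂ z + a₃ z)) * |s - t|) * R :=
    mul_le_mul hxx' (hTR _) (abs_nonneg _) (mul_nonneg (mul_nonneg hR (add_nonneg ha₂ ha₃)) (abs_nonneg _))
  calc |x| * |y - y'| + |x - x'| * |y'| ≤ (R * R) * (a₄ z * |s - t|) + ((R * (a₂ z + a₃ z)) * |s - t|) * R := add_le_add h1 h2'
    _ = (R ^ 2 * (a₂ z + a₃ z + a₄ z)) * |s - t| := by ring

/-- **DOBRUSHIN ACROSS THE CUT `{1,2}|{3,4}`**: the covariance of the two clamped products is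
`≤ R²·Σ_w((Dᵀa₁)_w + (Dᵀa₂)_w)((Dᵀa₃)_w + (Dᵀa₄)_w)∕c_w`. [folklore] -/
theorem clamped_pair_cov_le
    (hP : ∀ x F ω, P x F ω = (∫ s, F (update ω x s) * exp (-V (update ω x s))) / ∫ s, exp (-V (update ω x s)))
    (hV : ∀ x ω, HasDerivAt (fun s => V (update ω x s)) (V₁ x ω) (ω x))
    (hfloor : ∀ x ω s t, c x * (s - t) ^ 2 ≤ (V₁ x (update ω x s) - V₁ x (update ω x t)) * (s - t)) (hc : ∀ x, 0 < c x)
    (hceil : ∀ x ω s t, |V₁ x (update ω x s) - V₁ x (update ω x t)| ≤ Cw * |s - t|)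
    (hcross : ∀ x z, z ≠ x → ∀ ω s t, |V₁ x (update ω z s) - V₁ x (update ω z t)| ≤ J x z * |s - t|) (hVc : Continuous V)
    (hV0 : Integrable (fun ω : ι → ℝ => exp (-V ω))) (hV2 : ∀ z, Integrable (fun ω : ι → ℝ => ω z ^ 2 * exp (-V ω)))
    (hJ : ∀ x z, 0 ≤ J x z) (hJ0 : ∀ x, J x x = 0) (hrow : ∀ x, ∑ z, J x z / c x ≤ γ) (hγ0 : 0 ≤ γ) (hγ1 : γ < 1)
    (hD : ∀ x y, 0 ≤ D x y) (hDC : ∀ x y, (if x = y then (1 : ℝ) else 0) + ∑ z, D x z * (J z y / c z) ≤ D x y)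
    (h1 : ∀ z ω s t, |F₁ (update ω z s) - F₁ (update ω z t)| ≤ a₁ z * |s - t|)
    (h2 : ∀ z ω s t, |F₂ (update ω z s) - F₂ (update ω z t)| ≤ a₂ z * |s - t|)
    (h3 : ∀ z ω s t, |F₃ (update ω z s) - F₃ (update ω z t)| ≤ a₃ z * |s - t|)
    (h4 : ∀ z ω s t, |F₄ (update ω z s) - F₄ (update ω z t)| ≤ a₄ z * |s - t|) (m₁ m₂ m₃ m₄ : ℝ) {R : ℝ} (hR : 0 ≤ R) :
    |(∫ ω, (max (-R) (min R (F₁ ω - m₁)) * max (-R) (min R (F₂ ω - m₂))) * (max (-R) (min R (F₃ ω - m₃)) * max (-R) (min R (F₄ ω - m₄)))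
          ∂((volume : Measure (ι → ℝ)).tilted fun ω => -V ω)) -
        (∫ ω, max (-R) (min R (F₁ ω - m₁)) * max (-R) (min R (F₂ ω - m₂)) ∂((volume : Measure (ι → ℝ)).tilted fun ω => -V ω)) *
          (∫ ω, max (-R) (min R (F₃ ω - m₃)) * max (-R) (min R (F₄ ω - m₄)) ∂((volume : Measure (ι → ℝ)).tilted fun ω => -V ω))| ≤
      R ^ 2 * ∑ w, ((∑ z, D z w * a₁ z) + ∑ z, D z w * a₂ z) * ((∑ z, D z w * a₃ z) + ∑ z, D z w * a₄ z) / c w := by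
  have hX := clamped_prod_lipVec h1 h2 m₁ m₂ hR
  have hY := clamped_prod_lipVec h3 h4 m₃ m₄ hR
  have h447 := abs_cov_le_kernel_gibbs (F := fun ω => max (-R) (min R (F₁ ω - m₁)) * max (-R) (min R (F₂ ω - m₂)))
    (G := fun ω => max (-R) (min R (F₃ ω - m₃)) * max (-R) (min R (F₄ ω - m₄))) (a := fun z => R * (a₁ z + a₂ z)) (b := fun z => R * (a₃ z + a₄ z))
    hP hV hfloor hc hceil hcross hVc hV0 hV2 hJ hJ0 hrow hγ0 hγ1 hD hDC hX hY
  refine h447.trans (le_of_eq ?_)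
  rw [Finset.mul_sum]
  refine Finset.sum_congr rfl fun w _ => ?_
  have e1 : ∑ z, D z w * (R * (a₁ z + a₂ z)) = R * ((∑ z, D z w * a₁ z) + ∑ z, D z w * a₂ z) := by
    rw [← Finset.sum_add_distrib, Finset.mul_sum]
    exact Finset.sum_congr rfl fun z _ => by ring
  have e2 : ∑ z, D z w * (R * (a₃ z + a₄ z)) = R * ((∑ z, D z w * a₃ z) + ∑ z, D z w * a₄ z) := by
    rw [← Finset.sum_add_distrib, Finset.mul_sum]
    exact Finset.sum_congr rfl fun z _ => by ring
  rw [e1, e2]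
  ring

/-- **DOBRUSHIN ACROSS A CUT `{1}|{2,3,4}`**: `|Cov_ν(F₁, T_Rf₂·T_Rf₃·T_Rf₄)| ≤ R²·Σ_w(Dᵀa₁)_w((Dᵀa₂)_w + (Dᵀa₃)_w + (Dᵀa₄)_w)∕c_w`. [folklore] -/
theorem single_clamped_triple_cov_le
    (hP : ∀ x F ω, P x F ω = (∫ s, F (update ω x s) * exp (-V (update ω x s))) / ∫ s, exp (-V (update ω x s)))
    (hV : ∀ x ω, HasDerivAt (fun s => V (update ω x s)) (V₁ x ω) (ω x))
    (hfloor : ∀ x ω s t, c x * (s - t) ^ 2 ≤ (V₁ x (update ω x s) - V₁ x (update ω x t)) * (s - t)) (hc : ∀ x, 0 < c x)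
    (hceil : ∀ x ω s t, |V₁ x (update ω x s) - V₁ x (update ω x t)| ≤ Cw * |s - t|)
    (hcross : ∀ x z, z ≠ x → ∀ ω s t, |V₁ x (update ω z s) - V₁ x (update ω z t)| ≤ J x z * |s - t|) (hVc : Continuous V)
    (hV0 : Integrable (fun ω : ι → ℝ => exp (-V ω))) (hV2 : ∀ z, Integrable (fun ω : ι → ℝ => ω z ^ 2 * exp (-V ω)))
    (hJ : ∀ x z, 0 ≤ J x z) (hJ0 : ∀ x, J x x = 0) (hrow : ∀ x, ∑ z, J x z / c x ≤ γ) (hγ0 : 0 ≤ γ) (hγ1 : γ < 1)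
    (hD : ∀ x y, 0 ≤ D x y) (hDC : ∀ x y, (if x = y then (1 : ℝ) else 0) + ∑ z, D x z * (J z y / c z) ≤ D x y)
    (h1 : ∀ z ω s t, |F₁ (update ω z s) - F₁ (update ω z t)| ≤ a₁ z * |s - t|)
    (h2 : ∀ z ω s t, |F₂ (update ω z s) - F₂ (update ω z t)| ≤ a₂ z * |s - t|)
    (h3 : ∀ z ω s t, |F₃ (update ω z s) - F₃ (update ω z t)| ≤ a₃ z * |s - t|)
    (h4 : ∀ z ω s t, |F₄ (update ω z s) - F₄ (update ω z t)| ≤ a₄ z * |s - t|) (m₂ m₃ m₄ : ℝ) {R : ℝ} (hR : 0 ≤ R) :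
    |(∫ ω, F₁ ω * (max (-R) (min R (F₂ ω - m₂)) * max (-R) (min R (F₃ ω - m₃)) * max (-R) (min R (F₄ ω - m₄)))
          ∂((volume : Measure (ι → ℝ)).tilted fun ω => -V ω)) -
        (∫ ω, F₁ ω ∂((volume : Measure (ι → ℝ)).tilted fun ω => -V ω)) *
          (∫ ω, max (-R) (min R (F₂ ω - m₂)) * max (-R) (min R (F₃ ω - m₃)) * max (-R) (min R (F₄ ω - m₄))
            ∂((volume : Measure (ι → ℝ)).tilted fun ω => -V ω))| ≤
      R ^ 2 * ∑ w, (∑ z, D z w * a₁ z) * ((∑ z, D z w * a₂ z) + (∑ z, D z w * a₃ z) + ∑ z, D z w * a₄ z) / c w := by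
  have hY := clamped_triple_lipVec h2 h3 h4 m₂ m₃ m₄ hR
  have h447 := abs_cov_le_kernel_gibbs (F := F₁)
    (G := fun ω => max (-R) (min R (F₂ ω - m₂)) * max (-R) (min R (F₃ ω - m₃)) * max (-R) (min R (F₄ ω - m₄))) (a := a₁)
    (b := fun z => R ^ 2 * (a₂ z + a₃ z + a₄ z)) hP hV hfloor hc hceil hcross hVc hV0 hV2 hJ hJ0 hrow hγ0 hγ1 hD hDC h1 hY
  refine h447.trans (le_of_eq ?_)
  rw [Finset.mul_sum]
  refine Finset.sum_congr rfl fun w _ => ?_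
  have e2 : ∑ z, D z w * (R ^ 2 * (a₂ z + a₃ z + a₄ z)) = R ^ 2 * ((∑ z, D z w * a₂ z) + (∑ z, D z w * a₃ z) + ∑ z, D z w * a₄ z) := by
    rw [← Finset.sum_add_distrib, ← Finset.sum_add_distrib, Finset.mul_sum]
    exact Finset.sum_congr rfl fun z _ => by ring
  rw [e2]
  ring

/-! ## §2. THE END: the `2|2` group bound -/

/-- **THE END — THE `2|2` GROUP BOUND UNDER THE GIBBS LAW**: for the four class observables with arbitrary centring constants
(`f_i = F_i − m_i`), second∕fourth∕sixth centred moments `≤ m₂', m₄', m₆'` and every `R > 0`,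
`|∫f₁f₂f₃f₄dν − (∫f₁f₂)(∫f₃f₄)| ≤ R²·Σ_w(Dᵀ(a₁+a₂))_w(Dᵀ(a₃+a₄))_w∕c_w + (2m₄' + 2m₆' + 2m₂'(m₂'+m₄'))∕R`. [folklore] -/
theorem group_cov_two_two_le
    (hP : ∀ x F ω, P x F ω = (∫ s, F (update ω x s) * exp (-V (update ω x s))) / ∫ s, exp (-V (update ω x s)))
    (hV : ∀ x ω, HasDerivAt (fun s => V (update ω x s)) (V₁ x ω) (ω x))
    (hfloor : ∀ x ω s t, c x * (s - t) ^ 2 ≤ (V₁ x (update ω x s) - V₁ x (update ω x t)) * (s - t)) (hc : ∀ x, 0 < c x)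
    (hceil : ∀ x ω s t, |V₁ x (update ω x s) - V₁ x (update ω x t)| ≤ Cw * |s - t|)
    (hcross : ∀ x z, z ≠ x → ∀ ω s t, |V₁ x (update ω z s) - V₁ x (update ω z t)| ≤ J x z * |s - t|) (hVc : Continuous V)
    (hV0 : Integrable (fun ω : ι → ℝ => exp (-V ω))) (hV2 : ∀ z, Integrable (fun ω : ι → ℝ => ω z ^ 2 * exp (-V ω)))
    (hJ : ∀ x z, 0 ≤ J x z) (hJ0 : ∀ x, J x x = 0) (hrow : ∀ x, ∑ z, J x z / c x ≤ γ) (hγ0 : 0 ≤ γ) (hγ1 : γ < 1)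
    (hD : ∀ x y, 0 ≤ D x y) (hDC : ∀ x y, (if x = y then (1 : ℝ) else 0) + ∑ z, D x z * (J z y / c z) ≤ D x y)
    (h1 : ∀ z ω s t, |F₁ (update ω z s) - F₁ (update ω z t)| ≤ a₁ z * |s - t|)
    (h2 : ∀ z ω s t, |F₂ (update ω z s) - F₂ (update ω z t)| ≤ a₂ z * |s - t|)
    (h3 : ∀ z ω s t, |F₃ (update ω z s) - F₃ (update ω z t)| ≤ a₃ z * |s - t|)
    (h4 : ∀ z ω s t, |F₄ (update ω z s) - F₄ (update ω z t)| ≤ a₄ z * |s - t|) (m₁ m₂ m₃ m₄ : ℝ) {R M₂ M₄ M₆ : ℝ} (hR : 0 < R)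
    (hq1 : Integrable (fun ω => (F₁ ω - m₁) ^ 4) ((volume : Measure (ι → ℝ)).tilted fun ω => -V ω)) (hs1 : Integrable (fun ω => (F₁ ω - m₁) ^ 6)
        ((volume : Measure (ι → ℝ)).tilted fun ω => -V ω))
    (hq2 : Integrable (fun ω => (F₂ ω - m₂) ^ 4) ((volume : Measure (ι → ℝ)).tilted fun ω => -V ω)) (hs2 : Integrable (fun ω => (F₂ ω - m₂) ^ 6)
        ((volume : Measure (ι → ℝ)).tilted fun ω => -V ω))
    (hq3 : Integrable (fun ω => (F₃ ω - m₃) ^ 4) ((volume : Measure (ι → ℝ)).tilted fun ω => -V ω)) (hs3 : Integrable (fun ω => (F₃ ω - m₃) ^ 6)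
        ((volume : Measure (ι → ℝ)).tilted fun ω => -V ω))
    (hq4 : Integrable (fun ω => (F₄ ω - m₄) ^ 4) ((volume : Measure (ι → ℝ)).tilted fun ω => -V ω)) (hs4 : Integrable (fun ω => (F₄ ω - m₄) ^ 6)
        ((volume : Measure (ι → ℝ)).tilted fun ω => -V ω))
    (hM21 : ∫ ω, (F₁ ω - m₁) ^ 2 ∂((volume : Measure (ι → ℝ)).tilted fun ω => -V ω) ≤ M₂) (hM41 : ∫ ω, (F₁ ω - m₁) ^ 4 ∂((volume : Measure (ι →
        ℝ)).tilted fun ω => -V ω) ≤ M₄)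
    (hM61 : ∫ ω, (F₁ ω - m₁) ^ 6 ∂((volume : Measure (ι → ℝ)).tilted fun ω => -V ω) ≤ M₆)
    (hM22 : ∫ ω, (F₂ ω - m₂) ^ 2 ∂((volume : Measure (ι → ℝ)).tilted fun ω => -V ω) ≤ M₂) (hM42 : ∫ ω, (F₂ ω - m₂) ^ 4 ∂((volume : Measure (ι →
        ℝ)).tilted fun ω => -V ω) ≤ M₄)
    (hM62 : ∫ ω, (F₂ ω - m₂) ^ 6 ∂((volume : Measure (ι → ℝ)).tilted fun ω => -V ω) ≤ M₆)
    (hM23 : ∫ ω, (F₃ ω - m₃) ^ 2 ∂((volume : Measure (ι → ℝ)).tilted fun ω => -V ω) ≤ M₂) (hM43 : ∫ ω, (F₃ ω - m₃) ^ 4 ∂((volume : Measure (ι →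
        ℝ)).tilted fun ω => -V ω) ≤ M₄)
    (hM63 : ∫ ω, (F₃ ω - m₃) ^ 6 ∂((volume : Measure (ι → ℝ)).tilted fun ω => -V ω) ≤ M₆)
    (hM24 : ∫ ω, (F₄ ω - m₄) ^ 2 ∂((volume : Measure (ι → ℝ)).tilted fun ω => -V ω) ≤ M₂) (hM44 : ∫ ω, (F₄ ω - m₄) ^ 4 ∂((volume : Measure (ι →
        ℝ)).tilted fun ω => -V ω) ≤ M₄)
    (hM64 : ∫ ω, (F₄ ω - m₄) ^ 6 ∂((volume : Measure (ι → ℝ)).tilted fun ω => -V ω) ≤ M₆) :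
    |(∫ ω, (F₁ ω - m₁) * (F₂ ω - m₂) * (F₃ ω - m₃) * (F₄ ω - m₄) ∂((volume : Measure (ι → ℝ)).tilted fun ω => -V ω)) -
        (∫ ω, (F₁ ω - m₁) * (F₂ ω - m₂) ∂((volume : Measure (ι → ℝ)).tilted fun ω => -V ω)) *
          (∫ ω, (F₃ ω - m₃) * (F₄ ω - m₄) ∂((volume : Measure (ι → ℝ)).tilted fun ω => -V ω))| ≤
      R ^ 2 * (∑ w, ((∑ z, D z w * a₁ z) + ∑ z, D z w * a₂ z) * ((∑ z, D z w * a₃ z) + ∑ z, D z w * a₄ z) / c w) +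
        (2 * M₄ + 2 * M₆ + 2 * M₂ * (M₂ + M₄)) / R := by
  haveI : IsProbabilityMeasure ((volume : Measure (ι → ℝ)).tilted fun ω => -V ω) := isProbabilityMeasure_tilted hV0
  have hm1 : Measurable fun ω => F₁ ω - m₁ := (SupCoordinateLipschitzClass.measurable h1).sub_const m₁
  have hm2 : Measurable fun ω => F₂ ω - m₂ := (SupCoordinateLipschitzClass.measurable h2).sub_const m₂
  have hm3 : Measurable fun ω => F₃ ω - m₃ := (SupCoordinateLipschitzClass.measurable h3).sub_const m₃
  have hm4 : Measurable fun ω => F₄ ω - m₄ := (SupCoordinateLipschitzClass.measurable h4).sub_const m₄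
  have hT := clamped_pair_cov_le hP hV hfloor hc hceil hcross hVc hV0 hV2 hJ hJ0 hrow hγ0 hγ1 hD hDC h1 h2 h3 h4 m₁ m₂ m₃ m₄ hR.le
  have hT' : |(∫ ω, max (-R) (min R (F₁ ω - m₁)) * max (-R) (min R (F₂ ω - m₂)) * max (-R) (min R (F₃ ω - m₃)) * max (-R) (min R (F₄ ω - m₄))
          ∂((volume : Measure (ι → ℝ)).tilted fun ω => -V ω)) -
        (∫ ω, max (-R) (min R (F₁ ω - m₁)) * max (-R) (min R (F₂ ω - m₂)) ∂((volume : Measure (ι → ℝ)).tilted fun ω => -V ω)) *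
          (∫ ω, max (-R) (min R (F₃ ω - m₃)) * max (-R) (min R (F₄ ω - m₄)) ∂((volume : Measure (ι → ℝ)).tilted fun ω => -V ω))| ≤
      R ^ 2 * (∑ w, ((∑ z, D z w * a₁ z) + ∑ z, D z w * a₂ z) * ((∑ z, D z w * a₃ z) + ∑ z, D z w * a₄ z) / c w) := by
    refine le_trans (le_of_eq ?_) hT
    congr 2
    exact integral_congr_ae (ae_of_all _ fun ω => by ring)
  exact cov_group_le_of_truncated (f := fun ω => F₁ ω - m₁) (g := fun ω => F₂ ω - m₂) (h := fun ω => F₃ ω - m₃) (k := fun ω => F₄ ω - m₄)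
    hm1 hm2 hm3 hm4 hR hq1 hq2 hq3 hq4 hs1 hs2 hs3 hs4 hM21 hM22 hM23 hM24 hM41 hM42 hM43 hM44 hM61 hM62 hM63 hM64 hT'

/-! ## §3. Toy -/

/-- Toy (§1's bilinear expansion in numbers): `((1+1)·(1+1))∕1 = 4` crossing pairs. -/
example : (((1 : ℝ) + 1) * (1 + 1)) / 1 = 4 := by norm_num

end Summit.QuantumFields.BalabanUV.T4Continuum.NE7b.SupDobrushinGroupCovariance

end
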